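import Summits.Ventures.PercRepro.RankDistSeriesDegenerateSC
import Summits.Ventures.PercRepro.RankDistDirectSumSC

/-!
# PercRepro — SERIES-DEGENERATE CELLS SATISFY (SC) WITH TOP, SO THEIR DIRECT SUMS SATISFY (SC) AND C-025 (p9, gen 22)

On a series-degenerate cell (`RankDistSeriesDegenerate`: a series class of `k = p − q + 2` elements) the profile is
`s_u = c·C(k, u − q + 1)` for `q ≤ u < p` and `s_p = c·(k + 1)`, so TOP holds with room (`s_q = c·k < s_p`), and
with `shadowCumulative_of_series` the cell satisfies `ShadowCumulativeTop` (`shadowCumulativeTop_of_series`).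
`RankDistDirectSumSC` then gives the row (SC) and C-025 for the DIRECT SUM of two series-degenerate cells
(`shadowCumulative_disjointSum_of_series`, `rls_disjointSum_of_series`) — a family of DISCONNECTED matroids at every
pair of parameters, inside the open windows included. Nothing here moves any window of the crux.
-/

namespace PercRepro.RankDist

open Set Finset _root_.Matroid PercRepro.ThmH

variable {α : Type} [DecidableEq α]

/-- **Series-degenerate cells satisfy (SC) with TOP**: `s_q·C(n, v) ≤ s_v·C(n, q)` for every `q ≤ v ≤ p`. -/
theorem shadowCumulativeTop_of_series (M : Matroid α) [M.Finite] {p q : ℕ} (hn : (gr M).card = p + q)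
    (hr : M.eRank = (p : ℕ∞)) {S : Finset α} (hSE : (S : Set α) ⊆ M.E)
    (hser : ∀ x ∈ S, ∀ y ∈ S, x ≠ y → M.IsCocircuit {x, y}) (hnc : ∀ x ∈ S, ¬ M.IsColoop x)
    (hS2 : 2 ≤ S.card) (hk : S.card + q = p + 2) : ShadowCumulativeTop M p q := by
  intro v hqv hvp
  rcases Nat.lt_or_ge v p with hlt | hge
  · rcases Nat.eq_or_lt_of_le hqv with heq | hgt
    · rw [← heq]
    · exact shadowCumulative_of_series M hn hr hSE hser hnc hS2 hk v hgt hlt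
  · have hvp' : v = p := le_antisymm hvp hge
    subst hvp'
    rcases Nat.eq_or_lt_of_le hqv with heq | hlt
    · rw [heq]
    · rw [card_shadowLev_of_series M hn hr hSE hser hnc hS2 hk le_rfl hlt,
        card_shadowLev_top_of_series M hn hr hSE hser hnc hS2 hk, Nat.sub_self, Nat.zero_add,
        Nat.choose_one_right, Nat.choose_symm_add]
      exact Nat.mul_le_mul_right _ (Nat.mul_le_mul_left _ (Nat.le_succ _))

/-- **(SC) for the direct sum of two series-degenerate cells.** -/
theorem shadowCumulative_disjointSum_of_series (M N : Matroid α) [M.Finite] [N.Finite] (h : Disjoint M.E N.E)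
    [hS : (M.disjointSum N h).Finite] {p₁ q₁ p₂ q₂ : ℕ} (hn₁ : (gr M).card = p₁ + q₁)
    (hr₁ : M.eRank = (p₁ : ℕ∞)) (hn₂ : (gr N).card = p₂ + q₂) (hr₂ : N.eRank = (p₂ : ℕ∞))
    {S₁ : Finset α} (hS₁E : (S₁ : Set α) ⊆ M.E) (hser₁ : ∀ x ∈ S₁, ∀ y ∈ S₁, x ≠ y → M.IsCocircuit {x, y})
    (hnc₁ : ∀ x ∈ S₁, ¬ M.IsColoop x) (hS₁2 : 2 ≤ S₁.card) (hk₁ : S₁.card + q₁ = p₁ + 2)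
    {S₂ : Finset α} (hS₂E : (S₂ : Set α) ⊆ N.E) (hser₂ : ∀ x ∈ S₂, ∀ y ∈ S₂, x ≠ y → N.IsCocircuit {x, y})
    (hnc₂ : ∀ x ∈ S₂, ¬ N.IsColoop x) (hS₂2 : 2 ≤ S₂.card) (hk₂ : S₂.card + q₂ = p₂ + 2) :
    ShadowCumulative (M.disjointSum N h) (p₁ + p₂) (q₁ + q₂) := by
  have hE₁ := rk_ground_sdiff_of_series_degenerate M hr₁ hS₁E hser₁ hnc₁ hS₁2 hk₁
  have hE₂ := rk_ground_sdiff_of_series_degenerate N hr₂ hS₂E hser₂ hnc₂ hS₂2 hk₂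
  exact shadowCumulative_disjointSum M N h hn₁ hr₁ hn₂ hr₂ (by omega) (by omega)
    (shadowCumulativeTop_of_series M hn₁ hr₁ hS₁E hser₁ hnc₁ hS₁2 hk₁)
    (shadowCumulativeTop_of_series N hn₂ hr₂ hS₂E hser₂ hnc₂ hS₂2 hk₂)

/-- **C-025 for the direct sum of two series-degenerate cells.** -/
theorem rls_disjointSum_of_series (M N : Matroid α) [M.Finite] [N.Finite] (h : Disjoint M.E N.E)
    [hS : (M.disjointSum N h).Finite] {p₁ q₁ p₂ q₂ : ℕ} (hn₁ : (gr M).card = p₁ + q₁)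
    (hr₁ : M.eRank = (p₁ : ℕ∞)) (hn₂ : (gr N).card = p₂ + q₂) (hr₂ : N.eRank = (p₂ : ℕ∞))
    {S₁ : Finset α} (hS₁E : (S₁ : Set α) ⊆ M.E) (hser₁ : ∀ x ∈ S₁, ∀ y ∈ S₁, x ≠ y → M.IsCocircuit {x, y})
    (hnc₁ : ∀ x ∈ S₁, ¬ M.IsColoop x) (hS₁2 : 2 ≤ S₁.card) (hk₁ : S₁.card + q₁ = p₁ + 2)
    {S₂ : Finset α} (hS₂E : (S₂ : Set α) ⊆ N.E) (hser₂ : ∀ x ∈ S₂, ∀ y ∈ S₂, x ≠ y → N.IsCocircuit {x, y})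
    (hnc₂ : ∀ x ∈ S₂, ¬ N.IsColoop x) (hS₂2 : 2 ≤ S₂.card) (hk₂ : S₂.card + q₂ = p₂ + 2) :
    ThmN.RLS (M.disjointSum N h) (p₁ + p₂) (q₁ + q₂) :=
  rls_of_shadowCumulative _ _ _ (shadowCumulative_disjointSum_of_series M N h hn₁ hr₁ hn₂ hr₂ hS₁E hser₁ hnc₁
    hS₁2 hk₁ hS₂E hser₂ hnc₂ hS₂2 hk₂)

end PercRepro.RankDist
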